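import Summits.CriticalPhenomena.PercolationContinuityZ3.Theorems.PercNearOneGluingNoHeavyQuantIndepBlobTwoLightCellsHigh
import HarnessLib

/-!
# QUANT lane R8, T-DIB: Type-I chord cells for an ARBITRARY light cloud whose small sub-cloud fits under the level
# (pure real inequalities; P1-SURPLUS §23.9)

builds on p205010 (kernel theorem, internal audit signed; external expert review pending)

Support file (`--supports stmt-CriticalPhenomena-4575`), QUANT lane seat prim-quant-p1 (gen 12); memo
`run/shared/lean/prim/quant/P1-SURPLUS.md` §23.9.  Theorems only; no definitions, no sorries, standard axioms.

Setting: the pure light-cloud inequality (B″) of the memo, Type I (upper chord end at `A ≥ j+1`, lower level `u + 1`, `u = j − n₁`).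
Split the cloud at the level: BIG lights (`b > u`) must all be closed for `Λ ≤ u`, so `P(Λ ≤ u) = Π_big (1 − g) · P(Λ_small ≤ u)`.
When the SMALL sub-cloud fits (`Σ_small b ≤ u`) the second factor is `1`, its credit is at most `x·u`, and the cell is decided by
the number of big lights:
* no big light — the top cell (`…CloudTopCell`, needs non-mergeability);
* one big light `(B, G = x² + (1−x)a)` — `twoLight_cellC3` verbatim, with `(b, c)` the total size and average rate of the small cloud;
* two big lights — `Quant.IndepBlob.cloud_fitCell_twoBig` below (the argument of cell C4 with the extra small credit `≤ x u`);
* three or more big lights — the closure product is at most `(1 − x²)³ ≤ 1 − x` (`Quant.IndepBlob.closure_three_le`), so the lower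
  level already has value `≥ x` and the chord is trivial (`twoLight_chord_top_reduce`).
[cite: KozmaNitzan2024, Conjecture 3 (p. 15)] (the gluing rows served); [this work].
-/

namespace Summit.CriticalPhenomena.PercolationContinuityZ3.Theorems

namespace Quant

namespace IndepBlob

/-- Three sub-floor blobs with gates `≥ x²` (`1/2 ≤ x ≤ 1`) have closure product `≤ (1 − x²)³ ≤ 1 − x`. [this work] -/
theorem closure_three_le (x g₁ g₂ g₃ : ℝ) (hx : 1 / 2 ≤ x) (hx1 : x ≤ 1) (h1 : x ^ 2 ≤ g₁) (h1' : g₁ ≤ 1)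
    (h2 : x ^ 2 ≤ g₂) (h2' : g₂ ≤ 1) (h3 : x ^ 2 ≤ g₃) (h3' : g₃ ≤ 1) :
    (1 - g₁) * (1 - g₂) * (1 - g₃) ≤ 1 - x := by
  have e1 : 1 - g₁ ≤ 1 - x ^ 2 := by linarith
  have e2 : 1 - g₂ ≤ 1 - x ^ 2 := by linarith
  have e3 : 1 - g₃ ≤ 1 - x ^ 2 := by linarith
  have q1 : 0 ≤ 1 - g₁ := by linarith
  have q2 : 0 ≤ 1 - g₂ := by linarith
  have q3 : 0 ≤ 1 - g₃ := by linarith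
  have h12 : (1 - g₁) * (1 - g₂) ≤ (1 - x ^ 2) * (1 - x ^ 2) := mul_le_mul e1 e2 q2 (by nlinarith)
  have h123 : (1 - g₁) * (1 - g₂) * (1 - g₃) ≤ (1 - x ^ 2) * (1 - x ^ 2) * (1 - x ^ 2) :=
    mul_le_mul h12 e3 q3 (by nlinarith)
  -- `(1 − x²)³ ≤ 1 − x` on `[1/2, 1]`: `(1−x)²(1+x)³ ≤ 1`... as `(1+x)³ (1−x) ≤ 27/16 · ...`; direct polynomial certificate
  have hpoly : (1 - x ^ 2) * (1 - x ^ 2) * (1 - x ^ 2) ≤ 1 - x := by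
    have hε : 0 ≤ 1 - x := by linarith
    have e : (1 - x) - (1 - x ^ 2) * (1 - x ^ 2) * (1 - x ^ 2) = (1 - x) * (1 - (1 - x) * (1 - x) * (1 + x) ^ 3) := by ring
    have hin : (1 - x) * (1 - x) * (1 + x) ^ 3 ≤ 1 := by nlinarith [mul_nonneg hε (sub_nonneg.2 hx), sq_nonneg (x - 1 / 2), mul_nonneg (mul_nonneg hε hε) (sub_nonneg.2 hx)]
    nlinarith [e, mul_nonneg hε (sub_nonneg.2 hin)]
  linarith

/-- Arithmetic of the two-big-lights cell in the branch `(1−G)(1−g) > 1 − x` (then `a + c < 1/4`, big credit `< j/4`,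
`m > 7j/4 − x(j − n₁)`). [this work] -/
theorem cloud_fitCell_twoBig_aux (x a c j n₁ A m : ℝ) (hx : 1 / 2 < x) (hx1 : x < 1) (ha0 : 0 ≤ a) (hax : a ≤ x)
    (hc0 : 0 ≤ c) (hcx : c ≤ x) (hn1m : n₁ < m) (hmA : m ≤ A) (hn10 : 0 ≤ n₁) (hn1j : n₁ ≤ j) (hA2j : A ≤ 2 * j)
    (hm : 7 / 4 * j - x * (j - n₁) < m) :
    (A - m) * ((1 - x) * (1 + x - a) * ((1 - x) * (1 + x - c))) ≤ (1 - x) * (A - n₁) := by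
  have hε : 0 < 1 - x := by linarith
  have hr0 : 0 ≤ A - m := by linarith
  have hqq : (1 - x) * (1 + x - a) * ((1 - x) * (1 + x - c)) ≤ (1 - x) ^ 2 * (1 + x) ^ 2 := by
    have h1 : (1 + x - a) ≤ 1 + x := by linarith
    have h2 : (1 + x - c) ≤ 1 + x := by linarith
    have h3 := mul_le_mul h1 h2 (by linarith) (by linarith)
    have e : (1 - x) * (1 + x - a) * ((1 - x) * (1 + x - c)) = (1 - x) ^ 2 * ((1 + x - a) * (1 + x - c)) := by ring
    rw [e]
    exact mul_le_mul_of_nonneg_left (by nlinarith [h3]) (sq_nonneg _)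
  have hq0 : 0 ≤ (1 - x) * (1 + x - a) * ((1 - x) * (1 + x - c)) :=
    mul_nonneg (mul_nonneg hε.le (by linarith)) (mul_nonneg hε.le (by linarith))
  have h98 : (1 - x) * (1 + x) ^ 2 ≤ 9 / 8 := by nlinarith [sq_nonneg (x - 1 / 2), sq_nonneg x]
  -- `r < A − 7j/4 + x(j − n₁) =: R`, and `R · (9/8) ≤ A − n₁`
  have hR : A - m < A - 7 / 4 * j + x * (j - n₁) := by linarith
  by_cases hRpos : 0 < A - 7 / 4 * j + x * (j - n₁)
  · have hstep : (A - 7 / 4 * j + x * (j - n₁)) * ((1 - x) * (1 + x) ^ 2) ≤ A - n₁ := by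
      have h1 : (A - 7 / 4 * j + x * (j - n₁)) * ((1 - x) * (1 + x) ^ 2) ≤ (A - 7 / 4 * j + x * (j - n₁)) * (9 / 8) :=
        mul_le_mul_of_nonneg_left h98 hRpos.le
      nlinarith [h1]
    have h1 : (A - m) * ((1 - x) * (1 + x - a) * ((1 - x) * (1 + x - c))) ≤
        (A - 7 / 4 * j + x * (j - n₁)) * ((1 - x) ^ 2 * (1 + x) ^ 2) := mul_le_mul hR.le hqq hq0 hRpos.le
    have h2 : (A - 7 / 4 * j + x * (j - n₁)) * ((1 - x) ^ 2 * (1 + x) ^ 2) =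
        (1 - x) * ((A - 7 / 4 * j + x * (j - n₁)) * ((1 - x) * (1 + x) ^ 2)) := by ring
    have h3 : (1 - x) * ((A - 7 / 4 * j + x * (j - n₁)) * ((1 - x) * (1 + x) ^ 2)) ≤ (1 - x) * (A - n₁) :=
      mul_le_mul_of_nonneg_left hstep hε.le
    linarith [h1, h2, h3]
  · -- then `r < 0`: impossible, `r ≥ 0`
    linarith

/-- **Two big lights over a fitting small cloud** (Type I).  Big lights `(B, G = x² + (1−x)a)`, `(b, g = x² + (1−x)c)` with
`b, B ≤ j`; the small cloud contributes credit `Ks ≤ x(j − n₁)`; heavy side `n₁ < m ≤ A ≤ 2j`, `0 ≤ n₁ ≤ j`; credit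
`2j < m + (B a + b c + Ks)`.  Then `x(A − n₁) ≤ (A − m)(1 − (1−G)(1−g)) + (m − n₁)`. [this work] -/
theorem cloud_fitCell_twoBig (x a c G g B b j n₁ A m Ks : ℝ) (hx : 1 / 2 < x) (hx1 : x < 1)
    (ha0 : 0 ≤ a) (hax : a ≤ x) (hc0 : 0 ≤ c) (hcx : c ≤ x) (hG : G = x ^ 2 + (1 - x) * a) (hg : g = x ^ 2 + (1 - x) * c)
    (hb0 : 0 ≤ b) (hbj : b ≤ j) (hBj : B ≤ j) (hn1m : n₁ < m) (hmA : m ≤ A) (hn10 : 0 ≤ n₁) (hn1j : n₁ ≤ j)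
    (hA2j : A ≤ 2 * j) (hKs : Ks ≤ x * (j - n₁)) (hcr : 2 * j < m + (B * a + b * c + Ks)) :
    x * (A - n₁) ≤ (A - m) * (1 - (1 - G) * (1 - g)) + (m - n₁) * 1 := by
  have hε : 0 < 1 - x := by linarith
  have hqG : 1 - G = (1 - x) * (1 + x - a) := by rw [hG]; ring
  have hqg : 1 - g = (1 - x) * (1 + x - c) := by rw [hg]; ring
  have hid : (A - m) * (1 - (1 - G) * (1 - g)) + (m - n₁) * 1 - x * (A - n₁) =
      (1 - x) * (A - n₁) - (A - m) * ((1 - G) * (1 - g)) := by ring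
  have hr0 : 0 ≤ A - m := by linarith
  by_cases hq : (1 - G) * (1 - g) ≤ 1 - x
  · have h1 : (A - m) * ((1 - G) * (1 - g)) ≤ (A - m) * (1 - x) := mul_le_mul_of_nonneg_left hq hr0
    have h2 : (A - m) * (1 - x) ≤ (A - n₁) * (1 - x) := mul_le_mul_of_nonneg_right (by linarith) hε.le
    linarith [h1, h2, hid]
  · have hq' : 1 - x < (1 - G) * (1 - g) := not_le.mp hq
    have hσ : a + c < 1 / 4 := by
      by_contra h
      have := twoLight_closure_quarter x a c hx.le hx1.le hax hcx (not_lt.mp h)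
      rw [hqG, hqg] at hq'
      linarith
    have hK : B * a + b * c ≤ j * (a + c) := by
      have e1 := mul_le_mul_of_nonneg_right hBj ha0
      have e2 := mul_le_mul_of_nonneg_right hbj hc0
      linarith
    have hj : 0 ≤ j := le_trans hb0 hbj
    have hjσ : j * (a + c) ≤ j * (1 / 4) := mul_le_mul_of_nonneg_left hσ.le hj
    have hm : 7 / 4 * j - x * (j - n₁) < m := by linarith
    have haux := cloud_fitCell_twoBig_aux x a c j n₁ A m hx hx1 ha0 hax hc0 hcx hn1m hmA hn10 hn1j hA2j hm
    rw [hqG, hqg] at hid ⊢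
    linarith [hid, haux]

end IndepBlob

end Quant

end Summit.CriticalPhenomena.PercolationContinuityZ3.Theorems
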